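import Mathlib
import Literature.Analysis.FluidPDE.VectorCalculus
import Literature.Analysis.FluidPDE.VorticityCalculus
import Literature.Analysis.FluidPDE.TaoEnstrophyLocalisation
import Literature.Analysis.FluidPDE.LandauSolutions
import Literature.Analysis.FluidPDE.SverakLandauClassificationProofs
import Summits.NavierStokesRegularity.NavierStokesRegularity.Theorems.TypeIQuarterGateScarEnvelopeTypeIForcedTsaiTailDichotomy
import Summits.NavierStokesRegularity.NavierStokesRegularity.Theorems.ThreadingFluxAzimuthalCartanLocalCurlCurl
import Summits.NavierStokesRegularity.NavierStokesRegularity.Theorems.ThreadingFluxCentreJetLocalDriftLaw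
import Summits.NavierStokesRegularity.NavierStokesRegularity.Theorems.ThreadingFluxCentreJetRigidityReduction
import Summits.NavierStokesRegularity.NavierStokesRegularity.Theorems.ThreadingFluxAzimuthalCartanDefs
import HarnessLib

/-!
# Crux `PoloidalLiouville` (stmt-NavierStokesRegularity-1222, wall W1), crux idea «azimuthal-cartan-test» (ns-idea-15 g10,
# `Cruxes/PoloidalLiouville/AzimuthalCartanSketch.lean` v1.3c): C♯ ON THE SCALE-INVARIANT STRATUM, I — the homogeneous
# extension of a steady flow given on a shell, and Šverák

Support file (Theorems-side; seat ns-wall-eng-6 g4, cell `ns-wall-extremal`, W1 adjunct; `--supports stmt-NavierStokesRegularity-1222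
--as helper`; 0 kit).  Towards `Homogeneous.steadyShellRigidity_of_homogeneous` (file II, `…ShellHomogeneousRigidity.lean`): the card's
surviving conjecture C♯ `SteadyShellRigidity` HOLDS on the stratum of flows that are `(−1)`-homogeneous about the centre.  This file:

* `Homogeneous.smul_apply_smul_eq` — RAY CONSTANCY: Euler's identity `DW(y) y = −W y` on the shell `r₁ < ‖y‖ < r₂` (`0 < r₁`) integrates
  along rays (`s ↦ s • W(s • y)` has zero derivative on a connected interval): `t • W (t • y) = W y`;
* `Homogeneous.ext` — the `(−1)`-homogeneous extension `y ↦ (ρ₀/‖y‖) • W((ρ₀/‖y‖) • y)` from the sphere `‖y‖ = ρ₀`: it agrees with `W`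
  on the shell (`ext_eq_of_mem`), is EXACTLY scale invariant (`ext_smul`), `C^∞` off the vertex (`contDiffOn_ext`);
* `Homogeneous.ext_eq_landau` — it is divergence free and solves the steady Navier–Stokes system on `ℝ³ ∖ {0}` with the explicit
  `(−2)`-homogeneous pressure `½⟪G, y⟫`, `G = −ΔW̃ + (W̃·∇)W̃` (BY NAME from ns-wall-eng-1 g7's landed `TailDichotomy.gradient_pressure_eq`
  and the unconditional scaling lemmas `TailDichotomy.steadyResidual_rescale_eq` / `curl_steadyResidual_smul'` /
  `divergence_smul_of_homogeneous`; `curl G = 0` because `G = −∇q` near the shell — the tree's `curl_gradient_eq_zero_holds` localised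
  by `CentreJet.exists_contDiff_eventuallyEq_of_ball` and ns-wall-eng-7's `LocalCurlCurl.curl_eventuallyEq_of_eventuallyEq`), hence, by
  ŠVERÁK'S CLASSIFICATION (tree, PROVED: `Sverak2011_landauClassification_holds.of_profile`), a Landau solution; so on the shell
  `W = landauAxisField a A` (`Homogeneous.eq_landau_on_shell`).

HONEST LABEL: a structural lemma about analytic steady flows on shells that are scale invariant about the centre (information-grade);
C♯, `PoloidalLiouville` (1222), its steady stratum and NS regularity stay OPEN.
[cite: Sverak2011, §1 Theorem 1] [cite: MajdaBertozziCUP2002, §1.1 (vector identities)]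
-/

-- the summit and its single problem share the name (D-0017 nested layout)
set_option linter.dupNamespace false

noncomputable section

open Set Function Filter Metric
open scoped RealInnerProductSpace Topology Laplacian
open Literature.Analysis.FluidPDE
open Summit.NavierStokesRegularity.NavierStokesRegularity.Theorems.PoloidalLiouville.CentreJet (E3 IsUnthreadedAbout IsSteadyNSOn)
open Summit.NavierStokesRegularity.NavierStokesRegularity.Cruxes.ScarEnvelopeTypeI.ForcedTsai (TailDichotomy.steadyResidual_smul'
  TailDichotomy.steadyResidual_rescale_eq TailDichotomy.curl_steadyResidual_smul' TailDichotomy.divergence_smul_of_homogeneous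
  TailDichotomy.gradient_pressure_eq TailDichotomy.steadyResidual_congr)

namespace Summit.NavierStokesRegularity.NavierStokesRegularity.Theorems.PoloidalLiouville.AzimuthalCartan

namespace Homogeneous

/-! ### The shell about the origin -/

/-- Membership in the shell about `0` is a condition on the norm. -/
theorem mem_shell_zero {r₁ r₂ : ℝ} {y : E3} : y ∈ shell 0 r₁ r₂ ↔ r₁ < ‖y‖ ∧ ‖y‖ < r₂ := by
  simp [shell, dist_zero_right]

/-- Translation: `x ∈ shell x₀ r₁ r₂ ↔ x − x₀ ∈ shell 0 r₁ r₂`. -/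
theorem sub_mem_shell_zero {x₀ : E3} {r₁ r₂ : ℝ} {x : E3} : x - x₀ ∈ shell 0 r₁ r₂ ↔ x ∈ shell x₀ r₁ r₂ := by
  simp [shell, dist_eq_norm]

/-- `x₀ + y ∈ shell x₀ r₁ r₂ ↔ y ∈ shell 0 r₁ r₂`. -/
theorem add_mem_shell {x₀ : E3} {r₁ r₂ : ℝ} {y : E3} : x₀ + y ∈ shell x₀ r₁ r₂ ↔ y ∈ shell 0 r₁ r₂ := by
  simp [shell, dist_eq_norm]

/-- Points of a shell about `0` with `0 ≤ r₁` are non-zero. -/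
theorem ne_zero_of_mem_shell {r₁ r₂ : ℝ} (hr₁ : 0 ≤ r₁) {y : E3} (hy : y ∈ shell 0 r₁ r₂) : y ≠ 0 := by
  intro h
  rw [mem_shell_zero, h, norm_zero] at hy
  linarith [hy.1]

/-- A positive multiple `t • y` of a shell point lies in the shell iff `r₁ < t‖y‖ < r₂`. -/
theorem smul_mem_shell_zero {r₁ r₂ : ℝ} {y : E3} {t : ℝ} (ht : 0 < t) :
    t • y ∈ shell 0 r₁ r₂ ↔ r₁ < t * ‖y‖ ∧ t * ‖y‖ < r₂ := by
  rw [mem_shell_zero, norm_smul, Real.norm_of_nonneg ht.le]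

/-! ### Ray constancy from the Euler identity -/

/-- **Ray constancy.**  If `W` is differentiable on the shell about `0` and satisfies Euler's identity `DW(y) y = −W(y)` there, then
`t • W (t • y) = W y` whenever `y` and `t • y` both lie in the shell (`t > 0`): the function `s ↦ s • W(s • y)` has zero derivative on
the connected interval `{s | s • y ∈ shell}`. -/
theorem smul_apply_smul_eq {W : E3 → E3} {r₁ r₂ : ℝ} (hr₁ : 0 < r₁)
    (hd : ∀ y ∈ shell (0 : E3) r₁ r₂, DifferentiableAt ℝ W y) (hE : ∀ y ∈ shell (0 : E3) r₁ r₂, fderiv ℝ W y y = -W y)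
    {y : E3} (hy : y ∈ shell (0 : E3) r₁ r₂) {t : ℝ} (ht : 0 < t) (hty : t • y ∈ shell (0 : E3) r₁ r₂) :
    t • W (t • y) = W y := by
  have hy0 : y ≠ 0 := ne_zero_of_mem_shell hr₁.le hy
  have hny : 0 < ‖y‖ := norm_pos_iff.2 hy0
  set I : Set ℝ := Ioo (r₁ / ‖y‖) (r₂ / ‖y‖) with hI
  have hmemI : ∀ {s : ℝ}, 0 < s → (s ∈ I ↔ s • y ∈ shell (0 : E3) r₁ r₂) := by
    intro s hs
    rw [smul_mem_shell_zero hs, hI, mem_Ioo, div_lt_iff₀ hny, lt_div_iff₀ hny]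
  have hIpos : ∀ s ∈ I, 0 < s := fun s hs => lt_trans (div_pos hr₁ hny) hs.1
  set g : ℝ → E3 := fun s => s • W (s • y) with hg
  -- zero derivative on `I`
  have hderiv : ∀ s ∈ I, HasDerivAt g 0 s := by
    intro s hs
    have hs0 := hIpos s hs
    have hsy : s • y ∈ shell (0 : E3) r₁ r₂ := (hmemI hs0).1 hs
    have h1 : HasDerivAt (fun s : ℝ => s • y) y s := by simpa using (hasDerivAt_id s).smul_const y
    have h2 : HasDerivAt (fun s : ℝ => W (s • y)) (fderiv ℝ W (s • y) y) s :=
      (hd _ hsy).hasFDerivAt.comp_hasDerivAt s h1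
    have h3 : HasDerivAt (fun s : ℝ => s • W (s • y)) (s • fderiv ℝ W (s • y) y + (1 : ℝ) • W (s • y)) s :=
      (hasDerivAt_id' s).fun_smul h2
    have h4 : s • fderiv ℝ W (s • y) y + (1 : ℝ) • W (s • y) = 0 := by
      have := hE _ hsy
      rw [map_smul] at this
      rw [this, one_smul, neg_add_cancel]
    rw [h4] at h3
    exact h3
  have hdiff : DifferentiableOn ℝ g I := fun s hs => (hderiv s hs).differentiableAt.differentiableWithinAt
  have hconst := (convex_Ioo (r₁ / ‖y‖) (r₂ / ‖y‖)).is_const_of_fderivWithin_eq_zero hdiff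
    (fun s hs => by
      rw [fderivWithin_of_isOpen isOpen_Ioo hs, (hderiv s hs).hasFDerivAt.fderiv]
      ext; simp)
    ((hmemI ht).2 hty) ((hmemI one_pos).2 (by simpa using hy))
  simpa [hg] using hconst

/-! ### The `(−1)`-homogeneous extension of a field given on a shell -/

/-- The `(−1)`-homogeneous extension from the sphere of radius `ρ₀`: `ext W ρ₀ y = (ρ₀/‖y‖) • W ((ρ₀/‖y‖) • y)` (junk `0` at `y = 0`). -/
def ext (W : E3 → E3) (ρ₀ : ℝ) (y : E3) : E3 := (ρ₀ / ‖y‖) • W ((ρ₀ / ‖y‖) • y)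

/-- `ext W ρ₀ 0 = 0`. -/
theorem ext_zero (W : E3 → E3) (ρ₀ : ℝ) : ext W ρ₀ 0 = 0 := by simp [ext]

/-- **Exact scale invariance**: `ext (c • y) = c⁻¹ • ext y` for every `c > 0` and EVERY `y`. -/
theorem ext_smul (W : E3 → E3) (ρ₀ : ℝ) {c : ℝ} (hc : 0 < c) (y : E3) : ext W ρ₀ (c • y) = c⁻¹ • ext W ρ₀ y := by
  rcases eq_or_ne y 0 with rfl | hy
  · simp [ext]
  · have hn : ‖y‖ ≠ 0 := norm_ne_zero_iff.2 hy
    simp only [ext, norm_smul, Real.norm_of_nonneg hc.le, smul_smul]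
    have h1 : ρ₀ / (c * ‖y‖) * c = ρ₀ / ‖y‖ := by field_simp
    rw [h1]
    congr 1
    field_simp

/-- On the shell the extension IS the field (ray constancy with `t = ρ₀/‖y‖`), provided `r₁ < ρ₀ < r₂`. -/
theorem ext_eq_of_mem {W : E3 → E3} {r₁ r₂ ρ₀ : ℝ} (hr₁ : 0 < r₁) (h₁ : r₁ < ρ₀) (h₂ : ρ₀ < r₂)
    (hd : ∀ y ∈ shell (0 : E3) r₁ r₂, DifferentiableAt ℝ W y) (hE : ∀ y ∈ shell (0 : E3) r₁ r₂, fderiv ℝ W y y = -W y)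
    {y : E3} (hy : y ∈ shell (0 : E3) r₁ r₂) : ext W ρ₀ y = W y := by
  have hy0 : y ≠ 0 := ne_zero_of_mem_shell hr₁.le hy
  have hny : 0 < ‖y‖ := norm_pos_iff.2 hy0
  have ht : 0 < ρ₀ / ‖y‖ := div_pos (hr₁.trans h₁) hny
  have hty : (ρ₀ / ‖y‖) • y ∈ shell (0 : E3) r₁ r₂ := by
    rw [smul_mem_shell_zero ht, div_mul_cancel₀ _ hny.ne']
    exact ⟨h₁, h₂⟩
  exact smul_apply_smul_eq hr₁ hd hE hy ht hty

/-- Germ form: near a point of the shell, `ext W ρ₀ = W`. -/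
theorem ext_eventuallyEq {W : E3 → E3} {r₁ r₂ ρ₀ : ℝ} (hr₁ : 0 < r₁) (h₁ : r₁ < ρ₀) (h₂ : ρ₀ < r₂)
    (hd : ∀ y ∈ shell (0 : E3) r₁ r₂, DifferentiableAt ℝ W y) (hE : ∀ y ∈ shell (0 : E3) r₁ r₂, fderiv ℝ W y y = -W y)
    {y : E3} (hy : y ∈ shell (0 : E3) r₁ r₂) : ext W ρ₀ =ᶠ[𝓝 y] W := by
  filter_upwards [((isOpen_Ioo.preimage (continuous_id.dist continuous_const) : IsOpen (shell 0 r₁ r₂))).mem_nhds hy] with z hz using ext_eq_of_mem hr₁ h₁ h₂ hd hE hz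

/-- The multiple used by the extension lands on the sphere of radius `ρ₀`, inside the shell. -/
theorem div_norm_smul_mem_shell {r₁ r₂ ρ₀ : ℝ} (h₀ : 0 < ρ₀) (h₁ : r₁ < ρ₀) (h₂ : ρ₀ < r₂) {y : E3} (hy : y ≠ 0) :
    (ρ₀ / ‖y‖) • y ∈ shell (0 : E3) r₁ r₂ := by
  have hny : 0 < ‖y‖ := norm_pos_iff.2 hy
  rw [smul_mem_shell_zero (div_pos h₀ hny), div_mul_cancel₀ _ hny.ne']
  exact ⟨h₁, h₂⟩

/-- **Smoothness off the vertex**: if `W` is `C^∞` on the shell then `ext W ρ₀` is `C^∞` on `ℝ³ ∖ {0}`. -/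
theorem contDiffAt_ext {W : E3 → E3} {r₁ r₂ ρ₀ : ℝ} (h₀ : 0 < ρ₀) (h₁ : r₁ < ρ₀) (h₂ : ρ₀ < r₂)
    (hW : ∀ y ∈ shell (0 : E3) r₁ r₂, ContDiffAt ℝ (⊤ : ℕ∞) W y) {y : E3} (hy : y ≠ 0) :
    ContDiffAt ℝ (⊤ : ℕ∞) (ext W ρ₀) y := by
  have hn : ContDiffAt ℝ (⊤ : ℕ∞) (fun z : E3 => ρ₀ / ‖z‖) y :=
    contDiffAt_const.div (contDiffAt_norm ℝ hy) (norm_ne_zero_iff.2 hy)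
  have hs : ContDiffAt ℝ (⊤ : ℕ∞) (fun z : E3 => (ρ₀ / ‖z‖) • z) y := hn.smul contDiffAt_id
  have hWc : ContDiffAt ℝ (⊤ : ℕ∞) W ((ρ₀ / ‖y‖) • y) := hW _ (div_norm_smul_mem_shell h₀ h₁ h₂ hy)
  exact hn.smul (ContDiffAt.comp (f := fun z : E3 => (ρ₀ / ‖z‖) • z) y hWc hs)

/-- `ContDiffOn` form of `contDiffAt_ext` on `{0}ᶜ`. -/
theorem contDiffOn_ext {W : E3 → E3} {r₁ r₂ ρ₀ : ℝ} (h₀ : 0 < ρ₀) (h₁ : r₁ < ρ₀) (h₂ : ρ₀ < r₂)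
    (hW : ∀ y ∈ shell (0 : E3) r₁ r₂, ContDiffAt ℝ (⊤ : ℕ∞) W y) :
    ContDiffOn ℝ (⊤ : ℕ∞) (ext W ρ₀) {0}ᶜ := fun _ hy => (contDiffAt_ext h₀ h₁ h₂ hW hy).contDiffWithinAt

/-! ### The steady Navier–Stokes system for the extension off the vertex -/

section Extension

variable {W : E3 → E3} {q : E3 → ℝ} {r₁ r₂ ρ₀ : ℝ}

/-- The steady residual `G = −ΔU + (U·∇)U` of a field `U` (a local abbreviation, written out everywhere). -/
theorem residual_eq_neg_gradient_of_steady (hNS : IsSteadyNSOn (shell (0 : E3) r₁ r₂) W q) {y : E3}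
    (hy : y ∈ shell (0 : E3) r₁ r₂) : -((Δ W) y) + convect W W y = -(gradient q y) := by
  have h := hNS.2.2.2 y hy
  rw [convect_apply, ← h]
  abel

/-- On the shell the residual of the extension is `−∇q`. -/
theorem residual_ext_of_mem (hr₁ : 0 < r₁) (h₁ : r₁ < ρ₀) (h₂ : ρ₀ < r₂)
    (hW : AnalyticOnNhd ℝ W (shell (0 : E3) r₁ r₂)) (hNS : IsSteadyNSOn (shell (0 : E3) r₁ r₂) W q)
    (hE : ∀ y ∈ shell (0 : E3) r₁ r₂, fderiv ℝ W y y = -W y) {y : E3} (hy : y ∈ shell (0 : E3) r₁ r₂) :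
    -((Δ (ext W ρ₀)) y) + convect (ext W ρ₀) (ext W ρ₀) y = -(gradient q y) := by
  rw [TailDichotomy.steadyResidual_congr (ext_eventuallyEq hr₁ h₁ h₂ (fun z hz => (hW z hz).differentiableAt) hE hy),
    residual_eq_neg_gradient_of_steady hNS hy]

/-- Germ form on the shell: the residual of the extension agrees with `−∇q` near every shell point. -/
theorem residual_ext_eventuallyEq (hr₁ : 0 < r₁) (h₁ : r₁ < ρ₀) (h₂ : ρ₀ < r₂)
    (hW : AnalyticOnNhd ℝ W (shell (0 : E3) r₁ r₂)) (hNS : IsSteadyNSOn (shell (0 : E3) r₁ r₂) W q)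
    (hE : ∀ y ∈ shell (0 : E3) r₁ r₂, fderiv ℝ W y y = -W y) {y : E3} (hy : y ∈ shell (0 : E3) r₁ r₂) :
    (fun z => -((Δ (ext W ρ₀)) z) + convect (ext W ρ₀) (ext W ρ₀) z) =ᶠ[𝓝 y] fun z => -(gradient q z) := by
  filter_upwards [((isOpen_Ioo.preimage (continuous_id.dist continuous_const) : IsOpen (shell 0 r₁ r₂))).mem_nhds hy] with z hz using residual_ext_of_mem hr₁ h₁ h₂ hW hNS hE hz

/-- `−∇q` is differentiable on the shell (`q` analytic there). -/
theorem differentiableAt_neg_gradient (hq : AnalyticOnNhd ℝ q (shell (0 : E3) r₁ r₂)) {y : E3}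
    (hy : y ∈ shell (0 : E3) r₁ r₂) : DifferentiableAt ℝ (fun z => -(gradient q z)) y := by
  have hqy : ContDiffAt ℝ (⊤ : ℕ∞) q y := (hq y hy).contDiffAt
  have hg : ContDiffAt ℝ (⊤ : ℕ∞) (gradient q) y := by
    have h1 : ContDiffAt ℝ (⊤ : ℕ∞) (fderiv ℝ q) y := hqy.fderiv_right (m := (⊤ : ℕ∞)) (by norm_cast)
    exact (InnerProductSpace.toDual ℝ E3).symm.contDiff.contDiffAt.comp y h1
  exact (hg.differentiableAt (by simp)).neg

/-- `curl (−∇q) = 0` on the shell (the tree's `curl ∘ ∇ = 0`, localised by a bump cut-off). -/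
theorem curl_neg_gradient_eq_zero (hq : AnalyticOnNhd ℝ q (shell (0 : E3) r₁ r₂)) {y : E3}
    (hy : y ∈ shell (0 : E3) r₁ r₂) : curl (fun z => -(gradient q z)) y = 0 := by
  obtain ⟨ε, hε, hball⟩ := Metric.isOpen_iff.1 ((isOpen_Ioo.preimage (continuous_id.dist continuous_const) : IsOpen (shell 0 r₁ r₂))) y hy
  have hq2 : ContDiffOn ℝ 2 q (ball y ε) := fun z hz =>
    ((hq z (hball hz)).contDiffAt.of_le le_top).contDiffWithinAt
  obtain ⟨g, hg, hgq⟩ := CentreJet.exists_contDiff_eventuallyEq_of_ball hε hq2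
  have hgrad : (fun z => -(gradient q z)) =ᶠ[𝓝 y] fun z => -(gradient g z) := by
    filter_upwards [hgq.eventuallyEq_nhds] with z hz
    simp only [gradient, hz.symm.fderiv_eq]
  rw [(LocalCurlCurl.curl_eventuallyEq_of_eventuallyEq hgrad).eq_of_nhds, curl_eq_curlCLM, fderiv_fun_neg, map_neg,
    ← curl_eq_curlCLM, curl_gradient_eq_zero_holds g hg y, neg_zero]

/-- Vector-valued version of the tree's `contDiffAt_laplacian_of_contDiffOn`: the Laplacian of a map smooth off the origin is smooth
off the origin. -/
theorem contDiffAt_laplacian_vec {U : E3 → E3} (hU : ContDiffOn ℝ (⊤ : ℕ∞) U {0}ᶜ) {x : E3} (hx : x ≠ 0) :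
    ContDiffAt ℝ (⊤ : ℕ∞) (Δ U) x := by
  have hUx : ContDiffAt ℝ (⊤ : ℕ∞) U x := (hU x hx).contDiffAt (isOpen_compl_singleton.mem_nhds hx)
  rw [InnerProductSpace.laplacian_eq_iteratedFDeriv_stdOrthonormalBasis]
  refine ContDiffAt.sum fun i _ => ?_
  have h2 : ContDiffAt ℝ (⊤ : ℕ∞) (iteratedFDeriv ℝ 2 U) x :=
    hUx.iteratedFDeriv_right (m := (⊤ : ℕ∞)) (i := 2) (by exact le_of_eq (by norm_cast))
  exact (ContinuousMultilinearMap.apply ℝ (fun _ : Fin 2 => E3) E3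
    ![stdOrthonormalBasis ℝ E3 i, stdOrthonormalBasis ℝ E3 i]).contDiff.contDiffAt.comp x h2

/-- The steady residual of a map smooth off the origin is smooth off the origin. -/
theorem contDiffAt_residual {U : E3 → E3} (hU : ContDiffOn ℝ (⊤ : ℕ∞) U {0}ᶜ) {x : E3} (hx : x ≠ 0) :
    ContDiffAt ℝ (⊤ : ℕ∞) (fun z => -((Δ U) z) + convect U U z) x := by
  have hUx : ContDiffAt ℝ (⊤ : ℕ∞) U x := (hU x hx).contDiffAt (isOpen_compl_singleton.mem_nhds hx)
  have hD : ContDiffAt ℝ (⊤ : ℕ∞) (fderiv ℝ U) x := hUx.fderiv_right (m := (⊤ : ℕ∞)) (by norm_cast)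
  have hconv : ContDiffAt ℝ (⊤ : ℕ∞) (fun z => fderiv ℝ U z (U z)) x := hD.clm_apply hUx
  have e : convect U U = fun z => fderiv ℝ U z (U z) := funext fun z => convect_apply U U z
  rw [e]
  exact (contDiffAt_laplacian_vec hU hx).neg.add hconv

/-- **The extension solves the steady Navier–Stokes system off the vertex and is a Landau flow.**  For an analytic steady flow
`(W, q)` on the shell `r₁ < ‖y‖ < r₂` about `0` satisfying Euler's identity `DW(y) y = −W y` and with `curl W ≢ 0`, the
`(−1)`-homogeneous extension from the sphere `‖y‖ = ρ₀` (`r₁ < ρ₀ < r₂`) is, on `ℝ³ ∖ {0}`, a Landau solution `landauAxisField a A`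
for some unit axis `a` and `A > 1` — by Šverák's classification theorem (tree, PROVED). -/
theorem ext_eq_landau (hr₁ : 0 < r₁) (h₁ : r₁ < ρ₀) (h₂ : ρ₀ < r₂)
    (hW : AnalyticOnNhd ℝ W (shell (0 : E3) r₁ r₂)) (hq : AnalyticOnNhd ℝ q (shell (0 : E3) r₁ r₂))
    (hNS : IsSteadyNSOn (shell (0 : E3) r₁ r₂) W q) (hE : ∀ y ∈ shell (0 : E3) r₁ r₂, fderiv ℝ W y y = -W y)
    (hcurl : ∃ y ∈ shell (0 : E3) r₁ r₂, curl W y ≠ 0) :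
    ∃ a : E3, ‖a‖ = 1 ∧ ∃ A : ℝ, 1 < A ∧ ∀ x : E3, x ≠ 0 → ext W ρ₀ x = landauAxisField a A x := by
  have hρ₀ : 0 < ρ₀ := hr₁.trans h₁
  set U : E3 → E3 := ext W ρ₀ with hUdef
  have hom : ∀ c : ℝ, 0 < c → ∀ y : E3, U (c • y) = c⁻¹ • U y := fun c hc y => ext_smul W ρ₀ hc y
  have hUC : ContDiffOn ℝ (⊤ : ℕ∞) U {0}ᶜ := contDiffOn_ext hρ₀ h₁ h₂ fun z hz => (hW z hz).contDiffAt
  have hd : ∀ y ∈ shell (0 : E3) r₁ r₂, DifferentiableAt ℝ W y := fun z hz => (hW z hz).differentiableAt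
  -- the residual `G`
  set G : E3 → E3 := fun z => -((Δ U) z) + convect U U z with hGdef
  have hGshell : ∀ y ∈ shell (0 : E3) r₁ r₂, G =ᶠ[𝓝 y] fun z => -(gradient q z) := fun y hy =>
    residual_ext_eventuallyEq hr₁ h₁ h₂ hW hNS hE hy
  -- at an arbitrary `y ≠ 0`: differentiability of `G` and `curl G = 0`, transported from `λ • y ∈ shell`
  have hGd : ∀ y : E3, y ≠ 0 → DifferentiableAt ℝ G y := by
    intro y hy
    set c : ℝ := ρ₀ / ‖y‖ with hc
    have hc0 : 0 < c := div_pos hρ₀ (norm_pos_iff.2 hy)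
    have hcy : c • y ∈ shell (0 : E3) r₁ r₂ := div_norm_smul_mem_shell hρ₀ h₁ h₂ hy
    have h1 : DifferentiableAt ℝ G (c • y) :=
      ((hGshell _ hcy).differentiableAt_iff).2 (differentiableAt_neg_gradient hq hcy)
    have h2 : DifferentiableAt ℝ (fun z : E3 => G (c • z)) y :=
      h1.comp y ((differentiableAt_id).const_smul c)
    have h3 : DifferentiableAt ℝ (fun z : E3 => c ^ 3 • G (c • z)) y := h2.const_smul (c ^ 3)
    rwa [TailDichotomy.steadyResidual_rescale_eq hom hc0] at h3
  have hGcurl : ∀ y : E3, y ≠ 0 → curl G y = 0 := by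
    intro y hy
    set c : ℝ := ρ₀ / ‖y‖ with hc
    have hc0 : 0 < c := div_pos hρ₀ (norm_pos_iff.2 hy)
    have hcy : c • y ∈ shell (0 : E3) r₁ r₂ := div_norm_smul_mem_shell hρ₀ h₁ h₂ hy
    have h1 : curl G (c • y) = 0 := by
      rw [(LocalCurlCurl.curl_eventuallyEq_of_eventuallyEq (hGshell _ hcy)).eq_of_nhds]
      exact curl_neg_gradient_eq_zero hq hcy
    have h2 := TailDichotomy.curl_steadyResidual_smul' hom hc0 y
    rw [h1, eq_comm, smul_eq_zero] at h2
    exact h2.resolve_left (inv_ne_zero (pow_ne_zero 4 hc0.ne'))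
  -- the pressure and the equations
  set P : E3 → ℝ := fun z => (1 / 2 : ℝ) * ⟪G z, z⟫ with hPdef
  have hmom : ∀ x : E3, x ≠ 0 → convect U U x + gradient P x = (1 : ℝ) • (Δ U) x := by
    intro x hx
    have hg : gradient P x = -G x := TailDichotomy.gradient_pressure_eq hom (hGd x hx) (hGcurl x hx)
    rw [hg, hGdef, one_smul]
    simp only [neg_add_rev, neg_neg]
    abel
  have hdiv : ∀ x : E3, x ≠ 0 → VectorCalculus.divergence U x = 0 := by
    intro x hx
    set c : ℝ := ρ₀ / ‖x‖ with hc
    have hc0 : 0 < c := div_pos hρ₀ (norm_pos_iff.2 hx)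
    have hcx : c • x ∈ shell (0 : E3) r₁ r₂ := div_norm_smul_mem_shell hρ₀ h₁ h₂ hx
    rw [TailDichotomy.divergence_smul_of_homogeneous hom hc0 x,
      (LocalCurlCurl.divergence_eventuallyEq_of_eventuallyEq (ext_eventuallyEq hr₁ h₁ h₂ hd hE hcx)).eq_of_nhds,
      hNS.2.2.1 _ hcx, mul_zero]
  have hPC : ContDiffOn ℝ (⊤ : ℕ∞) P {0}ᶜ := by
    intro x hx
    have hG : ContDiffAt ℝ (⊤ : ℕ∞) G x := contDiffAt_residual hUC hx
    exact (contDiffAt_const.mul (hG.inner ℝ contDiffAt_id)).contDiffWithinAt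
  have hne : ∃ x : E3, U x ≠ 0 := by
    obtain ⟨y, hy, hcy⟩ := hcurl
    by_contra hall
    push Not at hall
    apply hcy
    have hU0 : U = fun _ => (0 : E3) := funext hall
    have hW0 : W =ᶠ[𝓝 y] fun _ => (0 : E3) := by
      rw [← hU0]; exact (ext_eventuallyEq hr₁ h₁ h₂ hd hE hy).symm
    rw [curl_eq_curlCLM, hW0.fderiv_eq, fderiv_const_apply, map_zero]
  obtain ⟨a, ha, A, hA, hL⟩ :=
    Sverak2011_landauClassification_holds.of_profile one_pos hUC hPC hmom hdiv hom hne
  exact ⟨a, ha, A, hA, fun x hx => by rw [hL x hx, one_smul]⟩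

/-- **On the shell itself**: the field is a Landau flow, `W y = landauAxisField a A y`. -/
theorem eq_landau_on_shell (hr₁ : 0 < r₁) (h₁₂ : r₁ < r₂)
    (hW : AnalyticOnNhd ℝ W (shell (0 : E3) r₁ r₂)) (hq : AnalyticOnNhd ℝ q (shell (0 : E3) r₁ r₂))
    (hNS : IsSteadyNSOn (shell (0 : E3) r₁ r₂) W q) (hE : ∀ y ∈ shell (0 : E3) r₁ r₂, fderiv ℝ W y y = -W y)
    (hcurl : ∃ y ∈ shell (0 : E3) r₁ r₂, curl W y ≠ 0) :
    ∃ a : E3, ‖a‖ = 1 ∧ ∃ A : ℝ, 1 < A ∧ ∀ y ∈ shell (0 : E3) r₁ r₂, W y = landauAxisField a A y := by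
  have h₁ : r₁ < (r₁ + r₂) / 2 := by linarith
  have h₂ : (r₁ + r₂) / 2 < r₂ := by linarith
  obtain ⟨a, ha, A, hA, hL⟩ := ext_eq_landau (ρ₀ := (r₁ + r₂) / 2) hr₁ h₁ h₂ hW hq hNS hE hcurl
  refine ⟨a, ha, A, hA, fun y hy => ?_⟩
  rw [← ext_eq_of_mem hr₁ h₁ h₂ (fun z hz => (hW z hz).differentiableAt) hE hy]
  exact hL y (ne_zero_of_mem_shell hr₁.le hy)

end Extension

end Homogeneous

end Summit.NavierStokesRegularity.NavierStokesRegularity.Theorems.PoloidalLiouville.AzimuthalCartan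

end
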